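/-
HarnessLib.Audit.CruxProbe — BC7: a DETERMINISTIC tautology / vacuity / rigidity probe for ONE crux (`#h21_crux_probe`).
Motivation (2026-08-17): KZ-StandardParts' crux `SpArcClosure` was proved as a rigidity tautology — its hypotheses force the
arc to be constant near 0, so the statement collapsed to a landed support item — and nothing mechanical had said so at birth.
Imported by NOTHING in the tree (like `HarnessLib.Audit.Check`): a probe file imports it explicitly next to the crux's
`Theses`/`Cruxes` module (+ the sub `Statement` module for P5). Imports Lean + HarnessLib.Audit.Tags only (no Mathlib: the
tactics are parsed at run time and reported `unavailable` where they do not exist; probe files get Mathlib through the route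
module they import). No LLM, no randomness: fixed tactic order, a heartbeat cap per attempt, wall budgets from options.
Fixtures + farm test: harness/gate/tests/h21_audit/F30_crux_probe.lean, harness/gate/tests/test_h21_crux_probe.sh.
Sweep driver: harness/scripts/bc7_sweep.py. Doc: docs/m5/BC7-CRUX-PROBE-SWEEP-2026-08-17.md.
-/
import Lean
import HarnessLib.Audit.Tags

/-!
# `#h21_crux_probe Fq.Crux [summit := Fq.Statement] [route := "route-id"]`

For a crux `C : Prop` (a `def C : Prop := stmt`; the DEFINIENS is probed, never the name) the statement is normalised to a
telescope `∀ xs, H₁ → … → H_k → G` (`forallTelescope` + `whnfR`; `¬P` is read as `P → False`; with `h21.cruxProbe.unfold`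
(default on) a goal or hypothesis whose head is a PROJECT `Prop` definition is delta-unfolded, at most
`h21.cruxProbe.unfoldDepth` levels, so `A → B` between two items exposes B's binders). `∃`/`↔`/`∧`-headed conclusions are
not opened — the shape line reports them. Then five batteries run, every tactic attempt under
`maxHeartbeats = h21.cruxProbe.cheapHeartbeats` (`h21.cruxProbe.heartbeats` for `exact?`; ×1000) with all exceptions caught, every
goal / battery / command under the wall budgets `h21.cruxProbe.goalMs` / `batteryMs` / `totalMs` (checked BETWEEN attempts):

* P1 OUTRIGHT — close `∀ xs, Hs → G` with the fixed portfolio `posTactics` ⇒ `crux.provable-cheap <tactic>` (or `crux.in-tree`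
  when the found proof leans on a project THEOREM visible from the probe file: the crux is already proved there — ledger drift).
* P2 VACUITY — `∀ xs, H₁ → … → H_k → False` with `vacTactics` ⇒ `crux.hyps-vacuous`; and per hypothesis
  `∀ (its data binders), H_i → False` ⇒ `crux.hyp-refutable <H_i>`.
* P3 RIGIDITY / DEGENERACY — table-driven templates (`templates`) instantiated from the binders: a function/family binder
  `f` ⇒ `Hs → ∀ a b, f a = f b`, `Hs → ∃ c, f = fun _ => c`, `f = id`, `f = 0`, for `f : ℝ → _` local constancy near `0⁺`, for
  `f : ℕ → _` eventual constancy; a `Set`/`Finset` binder ⇒ `= ∅`, `Set.Finite`, `Set.Subsingleton`; two binders of one type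
  that both occur in hypotheses ⇒ `Hs → a = b`; a `Filter.Tendsto f l _` hypothesis ⇒ `Hs → ∃ c, ∀ᶠ x in l, f x = c`.
  Any template the portfolio closes ⇒ `crux.rigid <template>[<binder>]` — unless the same tactic also closes the template with the
  hypotheses DROPPED (control goal): then the types force it (`Unit`-valued family …) ⇒ informational `crux.rigid-type-trivial`.
  ADDING A TEMPLATE = one row in `templates` (below).
* P4 CONCLUSION WITHOUT HYPOTHESES (only when P1 fired — the portfolio is monotone in hypotheses): `∀ data, G` ⇒
  `crux.concl-free`; `G` with the single `H_i` dropped ⇒ `crux.hyp-unused <H_i>`.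
* P5 SUMMIT (when `summit :=` is given, or `route :=` names a route whose `@[closes]` theorem is visible — its conclusion is
  the summit): `C → S` by `exact fun h => h | intro h; simpa using h | intro h; simpa [C, S] using h | intro h; aesop | intro h;
  exact?` ⇒ `crux.implies-summit` (BC2: summit strength); `S → C` ⇒ `crux.summit-implies` (informational only).

OUTPUT: one info message — a line per battery `P<n> <code|ok|timeout|skipped|n/a> <tactic/template> <ms>`, then
`VERDICT: TAUTOLOGY-SUSPECT (codes…) | CLEAN | ERROR`, then ONE machine-readable line
`H21_CRUX_PROBE_JSON {"h21_crux_probe": decl, "verdict", "codes", "informational", "fired":[…], "batteries":[…], "shape":{…}, …}`.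
It never throws. Consumers grep the `H21_CRUX_PROBE_JSON ` prefix (several probes per file are fine, one line each).
-/

open Lean Meta Elab Command

namespace HarnessLib.Audit.CruxProbe

/-! ## Options -/

register_option h21.cruxProbe.heartbeats : Nat := {
  defValue := 200000
  descr := "#h21_crux_probe: maxHeartbeats (×1000) per LIBRARY-SEARCH attempt (`exact?`; its lazy index build alone needs most of this)" }
register_option h21.cruxProbe.cheapHeartbeats : Nat := {
  defValue := 50000
  descr := "#h21_crux_probe: maxHeartbeats (×1000) per ordinary attempt (simp_all / aesop / omega …): a cheap tautology closes far below this; measured 2026-08-17, at 200000 a failing simp_all or aesop burns 10–20 s per attempt on a heavy crux" }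
register_option h21.cruxProbe.goalMs : Nat := {
  defValue := 6000
  descr := "#h21_crux_probe: wall-clock budget per goal (ms; checked between tactic attempts — a running attempt is bounded by heartbeats)" }
register_option h21.cruxProbe.batteryMs : Nat := {
  defValue := 45000
  descr := "#h21_crux_probe: wall-clock budget per battery (ms; checked between tactic attempts)" }
register_option h21.cruxProbe.totalMs : Nat := {
  defValue := 180000
  descr := "#h21_crux_probe: wall-clock budget for the whole command (ms; checked between tactic attempts)" }
register_option h21.cruxProbe.librarySearch : Bool := {
  defValue := true
  descr := "#h21_crux_probe: include `exact?` (last attempt of P1/P3/P5; the first use per process pays the library index build)" }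
register_option h21.cruxProbe.maxTemplates : Nat := {
  defValue := 24
  descr := "#h21_crux_probe: cap on instantiated P3 templates (table order × binder order, deterministic)" }
register_option h21.cruxProbe.maxHyps : Nat := {
  defValue := 12
  descr := "#h21_crux_probe: cap on per-hypothesis goals in P2 (refutable) and P4 (unused)" }
register_option h21.cruxProbe.unfold : Bool := {
  defValue := true
  descr := "#h21_crux_probe: delta-unfold project Prop definitions heading the goal / a hypothesis while telescoping" }
register_option h21.cruxProbe.unfoldDepth : Nat := {
  defValue := 3
  descr := "#h21_crux_probe: how many project definitions may be unfolded along the goal spine" }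

/-- Budget knobs (defaults = the option defaults). -/
structure Cfg where
  heartbeats : Nat := 200000
  cheapHeartbeats : Nat := 50000
  goalMs : Nat := 6000
  batteryMs : Nat := 45000
  totalMs : Nat := 180000
  librarySearch : Bool := true
  maxTemplates : Nat := 24
  maxHyps : Nat := 12
  unfold : Bool := true
  unfoldDepth : Nat := 3
  deriving Inhabited, Repr

/-- Read the `h21.cruxProbe.*` options by NAME with the `Cfg` defaults (not through the `register_option` decls, which are
`[init]` and cannot be evaluated by a file that INLINES this module — the dev / pre-landing mode of the sweep driver). -/
def Cfg.ofOptions (o : Options) : Cfg :=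
  let d : Cfg := {}
  { heartbeats := o.get `h21.cruxProbe.heartbeats d.heartbeats, cheapHeartbeats := o.get `h21.cruxProbe.cheapHeartbeats d.cheapHeartbeats,
    goalMs := o.get `h21.cruxProbe.goalMs d.goalMs,
    batteryMs := o.get `h21.cruxProbe.batteryMs d.batteryMs,
    totalMs := o.get `h21.cruxProbe.totalMs d.totalMs, librarySearch := o.get `h21.cruxProbe.librarySearch d.librarySearch,
    maxTemplates := o.get `h21.cruxProbe.maxTemplates d.maxTemplates, maxHyps := o.get `h21.cruxProbe.maxHyps d.maxHyps,
    unfold := o.get `h21.cruxProbe.unfold d.unfold, unfoldDepth := o.get `h21.cruxProbe.unfoldDepth d.unfoldDepth }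

def Cfg.toJson (c : Cfg) : Json :=
  Json.mkObj [("heartbeats", c.heartbeats), ("cheapHeartbeats", c.cheapHeartbeats), ("goalMs", c.goalMs), ("batteryMs", c.batteryMs), ("totalMs", c.totalMs), ("librarySearch", c.librarySearch),
    ("maxTemplates", c.maxTemplates), ("maxHyps", c.maxHyps), ("unfold", c.unfold), ("unfoldDepth", c.unfoldDepth)]

/-! ## Portfolios (FIXED order = determinism; `exact?` always last so a wall deadline drops it first) -/

/-- P1 / P3 / P4: close a `∀ …, … → G` goal outright. -/
def posTactics : Array String :=
  #["intros; simp_all", "intros; aesop", "intros; omega", "decide", "intros; norm_num", "intros; nlinarith",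
    "intros; positivity", "intros; tauto", "intros; (try simp_all); aesop", "intros; exact?"]
/-- P3: the same portfolio WITHOUT `exact?` (measured 2026-08-17 on SpArcClosure: 10–20 s per template goal in a heavy context, for
no template hit simp/aesop would not also find) so every instantiated template gets its turn inside the battery budget. -/
def rigidTactics : Array String := posTactics.filter fun t => (t.splitOn "exact?").length ≤ 1
/-- P2: hypotheses ⊢ False. -/
def vacTactics : Array String :=
  #["intros; simp_all", "intros; omega", "intros; linarith", "intros; nlinarith", "intros; norm_num at *", "intros; tauto",
    "intros; aesop"]
/-- P5: `C → S` / `S → C` in the restricted context of the probe file (`unfolds` = the two decl names for `simp`). -/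
def summitTactics (unfolds : String) : Array String :=
  #["exact fun h => h", "intro h; simpa using h", s!"intro h; simpa [{unfolds}] using h", "intro h; aesop",
    s!"intro h; (try simp only [{unfolds}] at h ⊢); aesop", s!"intro h; (try simp only [{unfolds}] at h ⊢); tauto",
    "intro h; exact?"]

/-! ## P3 template table

A template is a Prop written as TERM SYNTAX with `{placeholders}`; the trigger says which binders / hypotheses instantiate it
and what each placeholder is bound to. The instantiated template `T` is probed as `∀ xs, H₁ → … → H_k → T` with `posTactics`.
A template that does not elaborate for a given binder (wrong types: `f = id` when domain ≠ codomain, `= 0` without a `Zero`)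
is silently not applicable — so templates may be written optimistically. TO ADD ONE: append a row; no other code changes.
-/

/-- What instantiates a template. -/
inductive Trigger where
  /-- every non-Prop, non-instance binder whose type is a function type `α → β`; `dom` restricts the head constant of `α`.
  Placeholder `{f}`. -/
  | fnBinder (dom : Option Name := none)
  /-- every non-Prop, non-instance binder whose type's head constant is one of `heads` (empty = any non-Sort, non-function
  type) and not one of `exclude`. Placeholder `{x}`. -/
  | binderHead (heads : List Name) (exclude : List Name := [])
  /-- every pair of non-Prop, non-instance, non-Sort binders with definitionally equal types that BOTH occur in some
  hypothesis. Placeholders `{a}` `{b}`. -/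
  | samePair
  /-- every Prop hypothesis whose type is an application of `head`; `args` binds placeholders to argument positions
  (0-based, implicit arguments count). -/
  | hypApp (head : Name) (args : List (String × Nat))
  deriving Inhabited, Repr

structure Template where
  name : String
  trigger : Trigger
  /-- term syntax of a `Prop`, placeholders in braces -/
  body : String
  deriving Inhabited, Repr

/-- THE table (order matters: it is the probing order). -/
def templates : Array Template := #[
  { name := "const-fn",        trigger := .fnBinder,             body := "∀ a b, {f} a = {f} b" },
  { name := "const-fn-exists", trigger := .fnBinder,             body := "∃ c, {f} = fun _ => c" },
  { name := "fn-eq-id",        trigger := .fnBinder,             body := "{f} = id" },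
  { name := "fn-eq-zero",      trigger := .fnBinder,             body := "{f} = 0" },
  { name := "germ-const-0+",   trigger := .fnBinder (some `Real), body := "∃ ε : ℝ, 0 < ε ∧ ∀ s t : ℝ, 0 < s → s < ε → 0 < t → t < ε → {f} s = {f} t" },
  { name := "evtl-const-nat",  trigger := .fnBinder (some `Nat),  body := "∃ N : ℕ, ∀ n, N ≤ n → {f} n = {f} N" },
  { name := "set-empty",       trigger := .binderHead [`Set, `Finset], body := "{x} = ∅" },
  { name := "set-univ",        trigger := .binderHead [`Set],     body := "{x} = Set.univ" },
  { name := "set-finite",      trigger := .binderHead [`Set],     body := "Set.Finite {x}" },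
  { name := "set-subsingleton",trigger := .binderHead [`Set],     body := "Set.Subsingleton {x}" },
  { name := "obj-eq-zero",     trigger := .binderHead [] [`Nat, `Int, `Real, `Complex, `NNReal, `ENNReal, `Rat, `Fin], body := "{x} = 0" },
  { name := "pair-eq",         trigger := .samePair,             body := "{a} = {b}" },
  { name := "tendsto-evtl-const", trigger := .hypApp `Filter.Tendsto [("f", 2), ("l", 3)],
                                                                 body := "∃ c, Filter.Eventually (fun x => {f} x = c) {l}" }
]

/-! ## Small utilities -/

def trunc (s : String) (n : Nat) : String :=
  if s.length ≤ n then s else String.ofList (s.toList.take n) ++ "…"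

private def strArr (xs : Array String) : Json := Json.arr (xs.map Json.str)

private def ppTerm (e : Expr) (n : Nat := 160) : MetaM String := do
  let fmt ← try ppExpr e catch _ => pure (format (toString e))
  return trunc (fmt.pretty 120) n

/-- Module roots of the trusted floor (never unfolded, never "project"). -/
def libraryRoots : List Name :=
  [`Init, `Std, `Lean, `Lake, `Mathlib, `Batteries, `Aesop, `Qq, `ProofWidgets, `ImportGraph, `Plausible, `LeanSearchClient, `Cli, `Archive, `Counterexamples]

def isProjectConst (env : Environment) (n : Name) : Bool :=
  match env.getModuleIdxFor? n with
  | none => true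
  | some i => match moduleName? env i.toNat with
    | some m => !libraryRoots.contains m.getRoot
    | none => true

/-- Is `e` headed by a project `def … : … Prop` we may delta-unfold? -/
def projectPropDefHead? (env : Environment) (e : Expr) : Option Name :=
  match e.getAppFn.constName? with
  | some c =>
    if !isProjectConst env c then none else
    match env.find? c with
    | some (.defnInfo _) => some c
    | _ => none
  | none => none

/-! ## Telescope -/

/-- One binder of the normalised telescope. -/
structure Binder where
  fvar : Expr
  name : Name
  isProp : Bool
  isInst : Bool
  type : Expr          -- instantiated
  probeType : Expr     -- `type` with project Prop heads unfolded (what the tactic goals use)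
  shown : String
  deriving Inhabited

/-- Unfold project Prop definitions at the head of `t` (≤ `depth` times), reading `¬P` as it is. -/
def unfoldHead (env : Environment) (t : Expr) (depth : Nat) : MetaM (Expr × Array Name) := do
  let mut t := t
  let mut opened : Array Name := #[]
  for _ in [0:depth] do
    let t' ← whnfR t
    match projectPropDefHead? env t' with
    | some c =>
      match ← unfoldDefinition? t' with
      | some u => opened := opened.push c; t := u
      | none => t := t'; break
    | none => t := t'; break
  return (t, opened)

/-- Open `e` as `∀ xs, G`: `forallTelescope`, then repeatedly `whnfR` / read `¬P` as `P → False` / unfold a project Prop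
head of the goal (when `unfold`), re-entering the telescope each time. `k` gets the binders and the final goal. -/
partial def openTelescope {α} (env : Environment) (unfold : Bool) (fuel : Nat) (e : Expr)
    (k : Array Expr → Expr → Array Name → TermElabM α) (acc : Array Expr := #[]) (opened : Array Name := #[]) : TermElabM α :=
  forallTelescope e fun xs body => do
    let xs := acc ++ xs
    let body ← instantiateMVars body
    let b ← whnfR body
    if b.isForall then
      return ← openTelescope env unfold fuel b k xs opened
    if let some p := b.not? then
      return ← openTelescope env unfold fuel (← mkArrow p (mkConst ``False)) k xs opened
    if unfold && fuel > 0 then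
      if let some c := projectPropDefHead? env b then
        if ← isProp b then
          if let some u ← unfoldDefinition? b then
            return ← openTelescope env unfold (fuel - 1) u k xs (opened.push c)
    k xs body opened

/-- fvars of `xs` that `e` depends on, transitively through binder types. -/
def depClosure (xs : Array Binder) (e : Expr) : MetaM (Std.HashSet FVarId) := do
  let mut need : Std.HashSet FVarId := {}
  for fv in (collectFVars {} e).fvarIds do need := need.insert fv
  for i in [0:xs.size] do
    let x := xs[xs.size - 1 - i]!
    if need.contains x.fvar.fvarId! then
      for fv in (collectFVars {} x.probeType).fvarIds do need := need.insert fv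
      for fv in (collectFVars {} x.type).fvarIds do need := need.insert fv
  return need

/-- Build the closed goal `∀ (kept binders, probe types), g`; `none` if a dropped binder is still needed. -/
def mkGoal (xs : Array Binder) (keep : Array Bool) (g : Expr) : MetaM (Option Expr) := do
  let kept := (xs.zip keep).filterMap fun (b, k) => if k then some b else none
  let fvs := kept.map (·.fvar)
  let g ← instantiateMVars g
  let mut acc := g.abstract fvs
  for i in [0:kept.size] do
    let j := kept.size - 1 - i
    let b := kept[j]!
    let d := (b.probeType).abstract (fvs.extract 0 j)
    let bi ← b.fvar.fvarId!.getBinderInfo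
    acc := .forallE b.name d acc bi
  if xs.any (fun b => acc.containsFVar b.fvar.fvarId!) then return none
  if acc.hasLooseBVars then return none
  return some acc

/-! ## Tactic runner (same discipline as `#h21_ground`: parse at run time, heartbeat cap, never throw) -/

inductive TacOutcome where
  | closed (proof : Expr)
  | failed (msg : String)
  | unavailable

def tryTacticOn (goal : Expr) (tac : String) (heartbeats : Nat) : TermElabM TacOutcome := do
  let env ← getEnv
  match Parser.runParserCategory env `tactic s!"({tac})" "<h21_crux_probe>" with
  | .error _ => return .unavailable
  | .ok stx =>
    let g ← mkFreshExprMVar (some goal) (kind := .syntheticOpaque)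
    let start ← IO.getNumHeartbeats
    withTheReader Core.Context (fun c => { c with initHeartbeats := start, maxHeartbeats := heartbeats * 1000 }) do
      tryCatchRuntimeEx
        (do
          let gs ← Term.withDeclName `_h21_crux_probe <| Term.withoutErrToSorry <| withoutModifyingEnv <|
            Tactic.run g.mvarId! (Tactic.evalTactic stx)
          unless gs.isEmpty do return .failed "goals remain"
          let pf ← instantiateMVars g
          if pf.hasExprMVar then return .failed "unassigned metavariables"
          if pf.getUsedConstants.contains ``sorryAx then return .failed "proof uses sorry"
          return .closed pf)
        (fun e => do return .failed (trunc (← e.toMessageData.toString) 200))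

/-- One probing goal. -/
structure Goal where
  battery : String      -- P1 P2 P2h P3 P4 P4h P5up P5dn
  code : String         -- code reported if a tactic closes it
  label : String        -- tactic-independent description (template[binder], hypothesis name, …)
  goal : Expr
  tactics : Array String
  informational : Bool := false
  /-- a proof using any of these constants does not count (P5: the routes' own `@[closes]` theorems prove `C → S` by design) -/
  exclude : Array Name := #[]
  /-- wall budget for this goal (0 = `Cfg.goalMs`); P1 and `C → S` get a battery-sized budget so `exact?` is reached -/
  budgetMs : Nat := 0
  /-- CONTROL goal (P3): the same template WITHOUT the hypotheses. If the closing tactic also closes the control, the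
  degeneracy comes from the TYPES (a `Unit`-valued family is `= 0`, a `Fin 0`-indexed one is constant), not from the
  hypotheses — reported as informational `crux.rigid-type-trivial`, not as `crux.rigid` (sweep 2026-08-17 false positive:
  MirrorModularBoosts.DiagonalMirrorRPR, `lab : (j : Fin N) → Fin (deg j) → Unit`). -/
  control : Option Expr := none
  deriving Inhabited

structure Attempt where
  battery : String
  label : String
  tactic : String
  ms : Nat
  outcome : String

def Attempt.toJson (a : Attempt) : Json :=
  Json.mkObj [("battery", a.battery), ("label", a.label), ("tactic", a.tactic), ("ms", a.ms), ("outcome", a.outcome)]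

structure Fired where
  battery : String
  code : String
  label : String
  tactic : String
  ms : Nat
  informational : Bool
  usesProject : Array Name := #[]

def Fired.toJson (f : Fired) : Json :=
  Json.mkObj [("battery", f.battery), ("code", f.code), ("label", f.label), ("tactic", f.tactic), ("ms", f.ms),
    ("informational", f.informational), ("uses_project", strArr (f.usesProject.map (·.toString)))]

/-- Per-battery summary row. -/
structure BatteryRow where
  battery : String
  status : String        -- fired | ok | timeout | skipped | n/a
  what : String := ""
  ms : Nat := 0
  goals : Nat := 0
  attempts : Nat := 0

def BatteryRow.toJson (r : BatteryRow) : Json :=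
  Json.mkObj [("battery", r.battery), ("status", r.status), ("what", r.what), ("ms", r.ms), ("goals", r.goals), ("attempts", r.attempts)]

def BatteryRow.line (r : BatteryRow) : String :=
  s!"{r.battery} {r.status} {r.what} {r.ms}ms"

structure RunState where
  cfg : Cfg
  t0 : Nat
  trace : Array Attempt := #[]
  fired : Array Fired := #[]
  unavailable : Array String := #[]
  rows : Array BatteryRow := #[]

/-- Run every goal of one battery (first success per goal wins; the battery continues with the next goal so several
labels can fire), respecting the battery and total deadlines. -/
def runBattery (st : RunState) (battery : String) (goals : Array Goal) (skipWhy : Option String := none) : TermElabM RunState := do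
  let mut st := st
  if let some why := skipWhy then
    return { st with rows := st.rows.push { battery, status := "skipped", what := why } }
  if goals.isEmpty then
    return { st with rows := st.rows.push { battery, status := "n/a", what := "no applicable goal" } }
  let env ← getEnv
  let tb ← IO.monoMsNow
  let deadline := min (tb + st.cfg.batteryMs) (st.t0 + st.cfg.totalMs)
  let mut firedHere : Array String := #[]
  let mut attempts := 0
  let mut timedOut := false
  let mut goalCut : Array String := #[]
  for g in goals do
    if timedOut then break
    let goalDeadline := min ((← IO.monoMsNow) + (if g.budgetMs == 0 then st.cfg.goalMs else g.budgetMs)) deadline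
    for tac in g.tactics do
      if !st.cfg.librarySearch && (tac.splitOn "exact?").length > 1 then continue
      let now ← IO.monoMsNow
      if now > deadline then
        st := { st with trace := st.trace.push { battery, label := g.label, tactic := tac, ms := 0, outcome := "battery-deadline" } }
        timedOut := true
        break
      if now > goalDeadline then
        st := { st with trace := st.trace.push { battery, label := g.label, tactic := tac, ms := 0, outcome := "goal-deadline" } }
        goalCut := goalCut.push g.label
        break
      let a ← IO.monoMsNow
      let isLS := (tac.splitOn "exact?").length > 1
      let r ← tryTacticOn g.goal tac (if isLS then st.cfg.heartbeats else st.cfg.cheapHeartbeats)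
      let ms := (← IO.monoMsNow) - a
      attempts := attempts + 1
      match r with
      | .closed pf =>
        let used := pf.getUsedConstants
        let uses := used.filter fun c => isProjectConst env c && (match env.find? c with | some (.thmInfo _) => true | _ => false)
        let excluded := used.filter fun c => g.exclude.contains c
        unless excluded.isEmpty do
          st := { st with trace := st.trace.push { battery, label := g.label, tactic := tac, ms, outcome := s!"excluded: proof uses {excluded.toList}" } }
          continue
        -- P1 closed WITH a project theorem = the crux is already proved in the visible tree (ledger drift), not a tautology
        let code := if g.code == "crux.provable-cheap" && !uses.isEmpty then "crux.in-tree" else g.code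
        -- P3 control: does the same tactic close the template WITHOUT the hypotheses? then the types force it, not the crux
        let typeTrivial ← match g.control with
          | some ctl => do
            match ← tryTacticOn ctl tac (if isLS then st.cfg.heartbeats else st.cfg.cheapHeartbeats) with
            | .closed _ => pure true
            | _ => pure false
          | none => pure false
        let (code, informational) := if typeTrivial then ("crux.rigid-type-trivial", true) else (code, g.informational)
        st := { st with trace := st.trace.push { battery, label := g.label, tactic := tac, ms, outcome := if typeTrivial then "closed (control without hypotheses closes too: type-trivial)" else "closed" },
                        fired := st.fired.push { battery, code, label := g.label, tactic := tac, ms, informational, usesProject := uses } }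
        firedHere := firedHere.push (s!"{code} {g.label} `{tac}`" ++ (if uses.isEmpty then "" else s!" uses {(uses.toList.take 4)}"))
        break
      | .unavailable =>
        unless st.unavailable.contains tac do st := { st with unavailable := st.unavailable.push tac }
        st := { st with trace := st.trace.push { battery, label := g.label, tactic := tac, ms, outcome := "unavailable" } }
      | .failed msg =>
        st := { st with trace := st.trace.push { battery, label := g.label, tactic := tac, ms, outcome := "failed: " ++ trunc ((msg.replace "\n" " ")) 70 } }
  let ms := (← IO.monoMsNow) - tb
  let realFire := st.fired.any fun f => f.battery == battery && !f.informational
  let status := if realFire then "fired" else if timedOut then "timeout" else "ok"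
  let what := "; ".intercalate firedHere.toList ++ (if goalCut.isEmpty then "" else s!" (goal budget cut: {goalCut.toList})") ++
    (if timedOut then " (battery budget exhausted)" else "")
  return { st with rows := st.rows.push { battery, status, what, ms, goals := goals.size, attempts } }

/-! ## Template instantiation -/

/-- Elaborate template `body` with placeholders bound to `subst` (in the CURRENT local context); `none` = not applicable. -/
def elabTemplate (body : String) (subst : Array (String × Expr)) : TermElabM (Option Expr) := do
  let env ← getEnv
  let mut src := body
  let mut decls : Array (Name × (Array Expr → TermElabM Expr)) := #[]
  for (k, e) in subst do
    let nm := "bc7_" ++ k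
    src := src.replace ("{" ++ k ++ "}") nm
    let ty ← inferType e
    decls := decls.push (Name.mkSimple nm, fun _ => pure ty)
  match Parser.runParserCategory env `term src "<h21_crux_probe template>" with
  | .error _ => return none
  | .ok stx =>
    withLocalDeclsD decls fun vs => do
      let saved ← saveState
      try
        let e ← Term.withDeclName `_h21_crux_probe <| Term.withoutErrToSorry <| Term.withSynthesize <|
          Term.elabTermEnsuringType stx (some (mkSort Level.zero))
        let e ← instantiateMVars e
        if e.hasExprMVar || e.hasSyntheticSorry || e.getUsedConstants.contains ``sorryAx then
          saved.restore; return none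
        unless ← isProp e do
          saved.restore; return none
        let e := e.replaceFVars vs (subst.map (·.2))
        saved.restore
        return some e
      catch _ =>
        saved.restore
        return none

/-- Instantiate the template table against the telescope: `(label, T)` pairs in table × binder order, capped. -/
def instantiateTemplates (xs : Array Binder) (cap : Nat) : TermElabM (Array (String × Expr)) := do
  let mut out : Array (String × Expr) := #[]
  -- which data binders occur in some hypothesis
  let mut inHyp : Std.HashSet FVarId := {}
  for b in xs do
    if b.isProp then
      for fv in (collectFVars {} b.type).fvarIds do inHyp := inHyp.insert fv
  let data := xs.filter fun b => !b.isProp && !b.isInst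
  for t in templates do
    if out.size ≥ cap then break
    match t.trigger with
    | .fnBinder dom =>
      for b in data do
        if out.size ≥ cap then break
        let ty ← whnfR b.type
        unless ty.isForall do continue
        if let some d := dom then
          unless ty.bindingDomain!.getAppFn.isConstOf d do continue
        if let some e ← elabTemplate t.body #[("f", b.fvar)] then
          out := out.push (s!"{t.name}[{b.name}]", e)
    | .binderHead heads exclude =>
      for b in data do
        if out.size ≥ cap then break
        let ty ← whnfR b.type
        if ty.isSort || ty.isForall then continue
        let h? := ty.getAppFn.constName?
        unless heads.isEmpty do
          let some h := h? | continue
          unless heads.contains h do continue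
        if let some h := h? then
          if exclude.contains h then continue
        if let some e ← elabTemplate t.body #[("x", b.fvar)] then
          out := out.push (s!"{t.name}[{b.name}]", e)
    | .samePair =>
      let cands := data.filter fun b => inHyp.contains b.fvar.fvarId!
      let mut pairs := 0
      for i in [0:cands.size] do
        for j in [i+1:cands.size] do
          if out.size ≥ cap || pairs ≥ 6 then break
          let a := cands[i]!; let b := cands[j]!
          let ta ← whnfR a.type; let tb ← whnfR b.type
          if ta.isSort || tb.isSort then continue
          unless ← withNewMCtxDepth (isDefEq ta tb) do continue
          if let some e ← elabTemplate t.body #[("a", a.fvar), ("b", b.fvar)] then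
            out := out.push (s!"{t.name}[{a.name},{b.name}]", e)
            pairs := pairs + 1
    | .hypApp head args =>
      for b in xs do
        if out.size ≥ cap then break
        unless b.isProp do continue
        let ty := b.type.consumeMData
        unless ty.getAppFn.isConstOf head do continue
        let as := ty.getAppArgs
        if args.any (fun (_, i) => i ≥ as.size) then continue
        let subst := args.toArray.map fun (k, i) => (k, as[i]!)
        if let some e ← elabTemplate t.body subst then
          out := out.push (s!"{t.name}[{b.name}]", e)
  return out

/-! ## The probe -/

structure Shape where
  binders : Nat := 0
  hyps : Array String := #[]        -- shown Prop binders
  data : Array String := #[]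
  goalHead : String := ""
  goalKind : String := ""           -- forall-free head: exists | iff | and | or | eq | false | const:<n> | other
  goal : String := ""
  opened : Array String := #[]      -- project defs unfolded along the goal spine
  deriving Inhabited

def Shape.toJson (s : Shape) : Json :=
  Json.mkObj [("binders", s.binders), ("hyps", strArr s.hyps), ("data", strArr s.data), ("goal_head", s.goalHead),
    ("goal_kind", s.goalKind), ("goal", s.goal), ("unfolded", strArr s.opened)]

def Shape.line (s : Shape) : String :=
  s!"∀×{s.data.size} H×{s.hyps.size} ⊢ {s.goalKind}" ++ (if s.opened.isEmpty then "" else s!" (unfolded {s.opened.toList})")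

private def goalKindOf (g : Expr) : String :=
  match g.getAppFn.constName? with
  | some ``Exists => "exists"
  | some ``Iff => "iff"
  | some ``And => "and"
  | some ``Or => "or"
  | some ``Eq => "eq"
  | some ``False => "false"
  | some ``LE.le => "le"
  | some ``LT.lt => "lt"
  | some c => s!"const:{c}"
  | none => if g.isSort then "sort" else if g.isFVar then "fvar" else if (g.isApp && g.getAppFn.isFVar) then "fvar-app" else "other"

/-- Everything the batteries need, computed inside the telescope (goals are CLOSED terms). -/
structure Plan where
  shape : Shape := {}
  p1 : Array Goal := #[]
  p2 : Array Goal := #[]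
  p2h : Array Goal := #[]
  p3 : Array Goal := #[]
  p4 : Array Goal := #[]
  p4h : Array Goal := #[]
  notes : Array String := #[]
  deriving Inhabited

/-- Build the plan for statement `stmt` (the crux definiens, parameters as leading `∀`). -/
def buildPlan (env : Environment) (cfg : Cfg) (stmt : Expr) : TermElabM Plan := do
  openTelescope env cfg.unfold cfg.unfoldDepth stmt fun fvs g opened => do
    -- binders
    let mut xs : Array Binder := #[]
    let mut nH := 0
    let mut nX := 0
    for x in fvs do
      let ld ← x.fvarId!.getDecl
      let ty ← instantiateMVars ld.type
      let isP ← isProp ty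
      let (pty, _) ← if isP && cfg.unfold then unfoldHead env ty cfg.unfoldDepth else pure (ty, #[])
      -- stable labels: H1… for hypotheses (binder names are usually hygienic), the source name for data when it is a plain one
      let label ← if isP then do nH := nH + 1; pure (Name.mkSimple s!"H{nH}")
        else do
          nX := nX + 1
          let u := ld.userName.eraseMacroScopes
          pure (if u.isAnonymous || u.hasMacroScopes || ld.userName.hasMacroScopes || u.isInternal then Name.mkSimple s!"x{nX}" else u)
      xs := xs.push { fvar := x, name := label, isProp := isP, isInst := ld.binderInfo.isInstImplicit, type := ty,
                      probeType := pty, shown := s!"({label} : {← ppTerm ty 100})" }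
    let g ← instantiateMVars g
    let hyps := xs.filter (·.isProp)
    let shape : Shape := {
      binders := xs.size, hyps := hyps.map (·.shown), data := (xs.filter fun b => !b.isProp).map (·.shown),
      goalHead := (g.getAppFn.constName?.map (·.toString)).getD "", goalKind := goalKindOf g, goal := (← ppTerm g 200),
      opened := opened.map (·.toString) }
    let allKeep := xs.map fun _ => true
    let mut plan : Plan := { shape }
    -- P1 outright
    match ← mkGoal xs allKeep g with
    | some e => plan := { plan with p1 := #[{ battery := "P1", code := "crux.provable-cheap", label := "outright", goal := e, tactics := posTactics, budgetMs := cfg.batteryMs }] }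
    | none => plan := { plan with notes := plan.notes.push "P1: could not rebuild the closed goal" }
    -- P2 vacuity (joint) + per hypothesis
    if hyps.isEmpty then
      plan := { plan with notes := plan.notes.push "P2: no Prop hypotheses at the top telescope" }
    else
      if let some e ← mkGoal xs allKeep (mkConst ``False) then
        plan := { plan with p2 := #[{ battery := "P2", code := "crux.hyps-vacuous", label := "all-hyps⊢False", goal := e, tactics := vacTactics }] }
      let mut n := 0
      for i in [0:xs.size] do
        let b := xs[i]!
        unless b.isProp do continue
        if n ≥ cfg.maxHyps then break
        n := n + 1
        -- keep: b itself + the binders its type needs; goal False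
        let need ← depClosure xs b.probeType
        let keep := xs.mapIdx fun j c => j == i || (j < i && need.contains c.fvar.fvarId!)
        if let some e ← mkGoal xs keep (mkConst ``False) then
          plan := { plan with p2h := plan.p2h.push { battery := "P2h", code := "crux.hyp-refutable", label := s!"{b.name}", goal := e, tactics := vacTactics } }
    -- P3 templates (+ hypothesis-free control goal per template)
    let insts ← try instantiateTemplates xs cfg.maxTemplates catch _ => pure #[]
    for (label, t) in insts do
      if let some e ← mkGoal xs allKeep t then
        let needT ← depClosure xs t
        let keepCtl := xs.map fun c => !c.isProp || needT.contains c.fvar.fvarId!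
        let ctl ← if keepCtl.any (· == false) then mkGoal xs keepCtl t else pure none
        plan := { plan with p3 := plan.p3.push { battery := "P3", code := "crux.rigid", label, goal := e, tactics := rigidTactics, control := ctl } }
    -- P4 conclusion without hypotheses (all dropped / one dropped)
    unless hyps.isEmpty do
      let need ← depClosure xs g
      let keep := xs.map fun c => !c.isProp || need.contains c.fvar.fvarId!
      if keep.any (· == false) then
        if let some e ← mkGoal xs keep g then
          plan := { plan with p4 := #[{ battery := "P4", code := "crux.concl-free", label := "no-hyps", goal := e, tactics := posTactics }] }
      if hyps.size ≥ 2 then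
        let mut n := 0
        for i in [0:xs.size] do
          let b := xs[i]!
          unless b.isProp do continue
          if need.contains b.fvar.fvarId! then continue
          if n ≥ cfg.maxHyps then break
          n := n + 1
          let keep := xs.mapIdx fun j _ => j != i
          if let some e ← mkGoal xs keep g then
            plan := { plan with p4h := plan.p4h.push { battery := "P4h", code := "crux.hyp-unused", label := s!"{b.name}", goal := e, tactics := posTactics } }
    return plan

/-- The statement to probe for constant `c`: its definiens with parameters as leading `∀` (`none` + reason otherwise). -/
def cruxStatement (env : Environment) (c : Name) : MetaM (Except String (Expr × List Name)) := do
  match env.find? c with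
  | none => return .error s!"unknown declaration {c}"
  | some (.defnInfo d) =>
    let stmt ← lambdaTelescope d.value fun ps body => do
      unless ← isProp body do return none
      return some (← mkForallFVars ps body)
    match stmt with
    | some s => return .ok (s, d.levelParams)
    | none => return .error s!"{c} is not a Prop-valued definition"
  | some (.thmInfo _) => return .error s!"{c} is a theorem (already proved), not a crux definition"
  | some (.axiomInfo _) => return .error s!"{c} is an axiom, not a crux definition"
  | some _ => return .error s!"{c} is not a definition"

/-- Summit expression: explicit decl (must be a closed Prop constant) or the conclusion of the route's `@[closes]` theorem. -/
def summitExpr (env : Environment) (summit : Option Name) (route : Option String) : MetaM (Except String (Expr × String)) := do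
  match summit with
  | some s =>
    match env.find? s with
    | none => return .error s!"unknown summit declaration {s}"
    | some ci =>
      let e := mkConst s (ci.levelParams.map Level.param)
      unless ← isProp e do return .error s!"summit {s} is not a closed Prop (parameters?)"
      return .ok (e, s.toString)
  | none =>
    match route with
    | none => return .error "no summit"
    | some rid =>
      let cands := (allTags env).filter fun t => t.attr == `closes && t.arg == rid && env.contains t.decl
      match cands.toList.map (·.decl) |>.eraseDups with
      | [t] =>
        let some ci := env.find? t | return .error "closes theorem vanished"
        let r ← forallTelescope ci.type fun _ body => do
          let body ← instantiateMVars body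
          if body.hasFVar then return none else return some body
        match r with
        | some b => return .ok (b, s!"{← ppTerm b 80} (conclusion of {t})")
        | none => return .error s!"conclusion of {t} depends on its binders"
      | [] => return .error s!"no @[closes \"{rid}\"] theorem visible from this file"
      | more => return .error s!"several @[closes \"{rid}\"] theorems: {more}"

def marker : String := "H21_CRUX_PROBE_JSON"

/-- Tautology codes (fire the verdict); everything else a battery reports is informational. -/
def tautologyCodes : List String :=
  ["crux.provable-cheap", "crux.in-tree", "crux.hyps-vacuous", "crux.hyp-refutable", "crux.rigid", "crux.concl-free", "crux.hyp-unused", "crux.implies-summit"]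

/-- Core: returns (human lines, json). Never throws for analysable input; the caller still wraps it. -/
def probeCore (c : Name) (summit : Option Name) (route : Option String) (cfg : Cfg) : TermElabM (Array String × Json) := do
  let t0 ← IO.monoMsNow
  let env ← getEnv
  let mut lines : Array String := #[]
  let mut notes : Array String := #[]
  let (stmt, lvls) ← match ← cruxStatement env c with
    | .error why =>
      let j := Json.mkObj [("h21_crux_probe", c.toString), ("decl", c.toString), ("verdict", "ERROR"), ("error", why),
        ("codes", strArr #[]), ("v", (1 : Nat))]
      return (#[s!"#h21_crux_probe {c}: ERROR {why}", "VERDICT: ERROR"], j)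
    | .ok r => pure r
  let plan ← buildPlan env cfg stmt
  notes := notes ++ plan.notes
  let mut st : RunState := { cfg, t0 }
  -- P1
  st ← runBattery st "P1" plan.p1
  let p1Fired := st.fired.any (·.battery == "P1")
  -- P2
  st ← runBattery st "P2" plan.p2 (if plan.p2.isEmpty && plan.shape.hyps.isEmpty then some "no hypotheses" else none)
  st ← runBattery st "P2h" plan.p2h (if plan.shape.hyps.isEmpty then some "no hypotheses" else none)
  -- P3
  st ← runBattery st "P3" plan.p3 (if plan.p3.isEmpty then some "no template applies to these binders" else none)
  -- P4 (only informative when P1 fired: the portfolio is monotone in the hypotheses)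
  let p4Skip := if plan.shape.hyps.isEmpty then some "no hypotheses" else if !p1Fired then some "P1 did not fire (dropping hypotheses cannot help the same portfolio)" else none
  st ← runBattery st "P4" plan.p4 (p4Skip <|> (if plan.p4.isEmpty then some "the conclusion depends on every hypothesis" else none))
  st ← runBattery st "P4h" plan.p4h (p4Skip <|> (if plan.p4h.isEmpty then some "fewer than 2 droppable hypotheses" else none))
  -- P5
  let mut summitShown := ""
  match ← summitExpr env summit route with
  | .error why =>
    st := { st with rows := st.rows.push { battery := "P5", status := "skipped", what := why } }
  | .ok (s, shown) =>
    summitShown := shown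
    let ce := mkConst c (lvls.map Level.param)
    if ← isProp ce then
      -- names handed to `simp only […]`: the crux, the summit head, and the project definitions each unfolds to (abbrev chains
      -- like `_root_.X := Literature.….X`), at most 4 deep
      let chain (n : Name) : List Name := Id.run do
        let mut out : List Name := []
        let mut cur := n
        for _ in [0:4] do
          unless isProjectConst env cur do break
          match env.find? cur with
          | some (.defnInfo d) =>
            out := out ++ [cur]
            match d.value.getAppFn.constName? with
            | some nx => if nx == cur then break else cur := nx
            | none => break
          | _ => break
        return out
      let sHead? := match s.not? with
        | some p => p.getAppFn.constName?
        | none => s.getAppFn.constName?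
      let names := (chain c ++ (match sHead? with | some h => chain h | none => [])).eraseDups
      let unfolds := ", ".intercalate (names.map (·.toString))
      let closesThms := ((allTags env).filter fun t => t.attr == `closes).map (·.decl)
      let up : Goal := { battery := "P5", code := "crux.implies-summit", label := "C→S", goal := (← mkArrow ce s), tactics := summitTactics unfolds,
                         exclude := closesThms, budgetMs := cfg.batteryMs / 2 }
      let dnTacs := (summitTactics unfolds).filter fun t => (t.splitOn "exact?").length ≤ 1     -- informational: no library search
      let dn : Goal := { battery := "P5", code := "crux.summit-implies", label := "S→C", goal := (← mkArrow s ce), tactics := dnTacs, informational := true }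
      st ← runBattery st "P5" #[up, dn]
    else
      st := { st with rows := st.rows.push { battery := "P5", status := "skipped", what := s!"{c} has parameters; C→S needs a closed Prop" } }
  -- verdict
  let taut := st.fired.filter fun f => tautologyCodes.contains f.code && !f.informational
  let codes := (taut.map (·.code)).toList.eraseDups
  let info := ((st.fired.filter fun f => !(tautologyCodes.contains f.code) || f.informational).map (·.code)).toList.eraseDups
  let verdict := if codes.isEmpty then "CLEAN" else "TAUTOLOGY-SUSPECT"
  let timeouts := (st.rows.filter (·.status == "timeout")).map (·.battery)
  -- lines
  let routeShown := match route with | some r => s!"  route {r}" | none => ""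
  let summitLine := if summitShown.isEmpty then "" else s!"  summit {summitShown}"
  lines := lines.push (s!"#h21_crux_probe {c}  shape: {plan.shape.line}" ++ routeShown ++ summitLine)
  for r in st.rows do lines := lines.push r.line
  for n in notes do lines := lines.push s!"note: {n}"
  unless st.unavailable.isEmpty do lines := lines.push s!"unavailable tactics (no Mathlib?): {st.unavailable.toList}"
  lines := lines.push (s!"VERDICT: {verdict}" ++ (if codes.isEmpty then "" else s!" ({", ".intercalate codes})") ++
    (if info.isEmpty then "" else s!"  [informational: {", ".intercalate info}]") ++
    (if timeouts.isEmpty then "" else s!"  [timeouts: {", ".intercalate timeouts.toList}]"))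
  let j := Json.mkObj [
    ("h21_crux_probe", c.toString), ("decl", c.toString), ("verdict", verdict), ("codes", strArr codes.toArray),
    ("informational", strArr info.toArray), ("timeouts", strArr timeouts),
    ("fired", Json.arr (st.fired.map Fired.toJson)), ("batteries", Json.arr (st.rows.map BatteryRow.toJson)),
    ("shape", plan.shape.toJson), ("route", match route with | some r => (r : Json) | none => Json.null),
    ("summit", match summit with | some s => (s.toString : Json) | none => Json.null), ("summit_shown", summitShown),
    ("notes", strArr notes), ("unavailable", strArr st.unavailable), ("trace", Json.arr (st.trace.map Attempt.toJson)),
    ("options", cfg.toJson), ("tactics", Json.mkObj [("pos", strArr posTactics), ("rigid", strArr rigidTactics), ("vac", strArr vacTactics), ("summit", strArr (summitTactics "C, S"))]),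
    ("templates", Json.arr (templates.map fun t => Json.mkObj [("name", t.name), ("body", t.body)])),
    ("elapsed_ms", ((← IO.monoMsNow) - t0 : Nat)), ("v", (1 : Nat))]
  return (lines, j)

/-- FQ name if it exists, else name resolution against the open namespaces, else the name as written. -/
def resolveName (n : Name) : CommandElabM Name := do
  if (← getEnv).contains n then return n
  try liftCoreM (realizeGlobalConstNoOverloadCore n) catch _ => return n

/-- `#h21_crux_probe Fq.Crux [summit := Fq.Statement] [route := "route-id"]` — see the module doc. -/
syntax (name := h21CruxProbe) "#h21_crux_probe " ident (ppSpace &"summit" " := " ident)? (ppSpace &"route" " := " str)? : command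

@[command_elab h21CruxProbe] def elabH21CruxProbe : CommandElab := fun stx => do
  let raw := stx[1].getId.replacePrefix `_root_ .anonymous
  let summit := if stx[2].isNone then none else some (stx[2][2].getId.replacePrefix `_root_ .anonymous)
  let route := if stx[3].isNone then none else stx[3][2].isStrLit?
  let cfg := Cfg.ofOptions (← getOptions)
  -- the crux / summit idents are taken literally first (FQ names), then resolved against open namespaces
  let c ← resolveName raw
  let summit ← match summit with
    | some s => some <$> resolveName s
    | none => pure none
  let saved := (← get).messages
  -- the command itself runs WITHOUT a heartbeat cap (every tactic attempt sets its own): the attempts' heartbeats accumulate on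
  -- the global counter and would otherwise trip the file's `maxHeartbeats` in the bookkeeping between attempts
  let (lines, j) ← try
      liftTermElabM <| withTheReader Core.Context (fun ctx => { ctx with maxHeartbeats := 0 }) (probeCore c summit route cfg)
    catch e =>
      let msg ← e.toMessageData.toString
      pure (#[s!"#h21_crux_probe {c}: ERROR {trunc msg 300}", "VERDICT: ERROR"],
        Json.mkObj [("h21_crux_probe", c.toString), ("decl", c.toString), ("verdict", "ERROR"), ("error", trunc msg 500), ("codes", Json.arr #[]), ("v", (1 : Nat))])
  -- drop whatever the attempts logged (exact? suggestions, aesop warnings); keep earlier messages of the file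
  modify fun s => { s with messages := saved }
  logInfo ("\n".intercalate lines.toList ++ "\n" ++ marker ++ " " ++ j.compress)

end HarnessLib.Audit.CruxProbe
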